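import Mathlib
import HarnessLib

/-!
# Discrepancy on disjoint 0/1 pairs controls the spectral radius (Bilu–Linial 2006, Lemma 3.3)

Source. Y. Bilu, N. Linial, *Lifts, discrepancy and nearly optimal spectral gap*, Combinatorica
**26** (5) (2006) 495–519 [BiluLinial2006], Lemma 3.3 (p. 500; proof pp. 502–505):

> "**Lemma 3.3.** Let `A` be an `n × n` real symmetric matrix such that the `l₁` norm of each row
> in `A` is at most `d`, and all diagonal entries of `A` are, in absolute value,
> `O(α(log(d/α) + 1))`. Assume that for any two vectors, `u, v ∈ {0, 1}ⁿ`, with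
> `supp(u) ∩ supp(v) = ∅`: `|uᵗAv| / (‖u‖ ‖v‖) ≤ α`. Then the spectral radius of `A` is
> `O(α(log(d/α) + 1))`."

(Abstract, p. 495: "An interesting consequence of this lemma is a converse to the Expander Mixing
Lemma", Cor. 5.1 there; p. 505: the bound is tight up to constant factors by an example of
Bollobás–Nikiforov.) The proof (pp. 502–505) first treats zero diagonal (dyadic level sets of an
eigenvector, the discrepancy hypothesis on each pair of levels, and a counting of the `l₁` row
mass), then writes `A = B + D` with `D` the diagonal and adds the two bounds (p. 505: "The spectral
radius of `A` is at most the sum of these bounds – also `O(α(log(d/α) + 1))`").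

Rendering (D-0014 named fact; the proof is a two-page real-analysis argument, not re-done here).
* The two `O(·)` are ABSOLUTE constants (independent of `n`, `A`, `d`, `α`, as the lemma is used for
  growing `n`): the constant `c₁` of the diagonal hypothesis is arbitrary and the constant `c₂` of
  the conclusion may depend on it — `∀ c₁, ∃ c₂, ∀ n A d α, …`.
* "Spectral radius `≤ C`" of a real symmetric matrix is rendered as the Rayleigh-quotient bound
  `|xᵗ A x| ≤ C · xᵗx` for every real vector `x`; for symmetric `A` this is equivalent to
  `max |eigenvalue| ≤ C` (numerical radius = spectral radius), and it is the form consumers use.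
* `u, v ∈ {0,1}ⁿ` with disjoint supports: coordinates `0 ∨ 1` and `uᵢ = 0 ∨ vᵢ = 0`; for such
  vectors `‖u‖ ‖v‖ = √((∑ uᵢ)(∑ vᵢ))`.
* The regime `0 < α ≤ d` is made explicit (taking `u = eᵢ`, `v = eⱼ` in the hypothesis gives
  `|Aᵢⱼ| ≤ α`, and `log(d/α) + 1 > 0` needs `α < e·d`); these extra hypotheses only WEAKEN the
  vendored statement relative to print. `log` is the natural logarithm (the base is immaterial
  inside `O(·)`).

Consumers: the «sfm-bl» line on `stmt-PneNP-19962` (`Summit.PneNP.PneNP.Theorems.CandCutNorm…`,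
PROOF-SFM-BL.md Lemma 6), which applies the lemma as a black box to a sparse remainder matrix with
zero diagonal — see the proved corollary `BiluLinial2006_lemma_3_3.zero_diagonal` below (and
`.unit_diagonal` for the diagonal constant `1`). Honest framing: a 2006 lemma of spectral graph
theory, vendored as a cited fact; nothing here bears on P versus NP.
-/

namespace Literature.Combinatorics.Expanders

open Matrix

/-- **Bilu–Linial 2006, Lemma 3.3** (Combinatorica 26, p. 500; proof pp. 502–505): "Let `A` be an
`n × n` real symmetric matrix such that the `l₁` norm of each row in `A` is at most `d`, and all
diagonal entries of `A` are, in absolute value, `O(α(log(d/α) + 1))`. Assume that for any two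
vectors, `u, v ∈ {0,1}ⁿ`, with `supp(u) ∩ supp(v) = ∅`: `|uᵗAv| / (‖u‖‖v‖) ≤ α`. Then the spectral
radius of `A` is `O(α(log(d/α) + 1))`." Rendered with absolute constants (`∀ c₁ ∃ c₂`), the
spectral radius of the symmetric matrix `A` as the Rayleigh bound `|xᵗAx| ≤ C·xᵗx`, and the regime
`0 < α ≤ d` explicit (module docstring). [cite: BiluLinial2006, Lemma 3.3 (p. 500; proof pp. 502–505)] -/
def BiluLinial2006_lemma_3_3 : Prop :=
  ∀ c₁ : ℝ, ∃ c₂ : ℝ, ∀ (n : ℕ) (A : Matrix (Fin n) (Fin n) ℝ) (d α : ℝ),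
    A.IsSymm → 0 < α → α ≤ d →
    (∀ i, ∑ j, |A i j| ≤ d) →
    (∀ i, |A i i| ≤ c₁ * (α * (Real.log (d / α) + 1))) →
    (∀ u v : Fin n → ℝ, (∀ i, u i = 0 ∨ u i = 1) → (∀ i, v i = 0 ∨ v i = 1) →
        (∀ i, u i = 0 ∨ v i = 0) →
        |u ⬝ᵥ (A *ᵥ v)| ≤ α * Real.sqrt ((∑ i, u i) * (∑ i, v i))) →
    ∀ x : Fin n → ℝ, |x ⬝ᵥ (A *ᵥ x)| ≤ c₂ * (α * (Real.log (d / α) + 1)) * (x ⬝ᵥ x)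

/-- **Zero-diagonal form** of Bilu–Linial Lemma 3.3 (the case treated first in the printed proof,
p. 502: "assume first that all diagonal entries of `A` are zeros"; it is the form the abstract
states, p. 495), with a POSITIVE absolute constant: from the fact with `c₁ = 0`.
[cite: BiluLinial2006, Lemma 3.3 (p. 500) and abstract (p. 495)] -/
theorem BiluLinial2006_lemma_3_3.zero_diagonal (h : BiluLinial2006_lemma_3_3) :
    ∃ c : ℝ, 0 < c ∧ ∀ (n : ℕ) (A : Matrix (Fin n) (Fin n) ℝ) (d α : ℝ),
      A.IsSymm → 0 < α → α ≤ d →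
      (∀ i, ∑ j, |A i j| ≤ d) →
      (∀ i, A i i = 0) →
      (∀ u v : Fin n → ℝ, (∀ i, u i = 0 ∨ u i = 1) → (∀ i, v i = 0 ∨ v i = 1) →
          (∀ i, u i = 0 ∨ v i = 0) →
          |u ⬝ᵥ (A *ᵥ v)| ≤ α * Real.sqrt ((∑ i, u i) * (∑ i, v i))) →
      ∀ x : Fin n → ℝ, |x ⬝ᵥ (A *ᵥ x)| ≤ c * (α * (Real.log (d / α) + 1)) * (x ⬝ᵥ x) := by
  obtain ⟨c₂, hc₂⟩ := h 0
  refine ⟨max c₂ 1, lt_of_lt_of_le zero_lt_one (le_max_right _ _), ?_⟩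
  intro n A d α hsymm hα hαd hrow hdiag hdisc x
  have hlog : 0 ≤ α * (Real.log (d / α) + 1) := by
    refine mul_nonneg hα.le ?_
    have : 0 ≤ Real.log (d / α) := Real.log_nonneg ((one_le_div hα).mpr hαd)
    linarith
  have hxx : 0 ≤ x ⬝ᵥ x := by
    simpa [dotProduct] using Finset.sum_nonneg fun i _ => mul_self_nonneg (x i)
  have h1 := hc₂ n A d α hsymm hα hαd hrow (fun i => by simp [hdiag i]) hdisc x
  refine h1.trans ?_
  have : c₂ * (α * (Real.log (d / α) + 1)) * (x ⬝ᵥ x) ≤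
      max c₂ 1 * (α * (Real.log (d / α) + 1)) * (x ⬝ᵥ x) :=
    mul_le_mul_of_nonneg_right (mul_le_mul_of_nonneg_right (le_max_left _ _) hlog) hxx
  exact this

/-- **Unit diagonal-constant form** of Bilu–Linial Lemma 3.3 (the diagonal hypothesis with
constant `1`: `|Aᵢᵢ| ≤ α(log(d/α) + 1)`), with a positive absolute constant in the conclusion: from
the fact with `c₁ = 1`. [cite: BiluLinial2006, Lemma 3.3 (p. 500)] -/
theorem BiluLinial2006_lemma_3_3.unit_diagonal (h : BiluLinial2006_lemma_3_3) :
    ∃ c : ℝ, 0 < c ∧ ∀ (n : ℕ) (A : Matrix (Fin n) (Fin n) ℝ) (d α : ℝ),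
      A.IsSymm → 0 < α → α ≤ d →
      (∀ i, ∑ j, |A i j| ≤ d) →
      (∀ i, |A i i| ≤ α * (Real.log (d / α) + 1)) →
      (∀ u v : Fin n → ℝ, (∀ i, u i = 0 ∨ u i = 1) → (∀ i, v i = 0 ∨ v i = 1) →
          (∀ i, u i = 0 ∨ v i = 0) →
          |u ⬝ᵥ (A *ᵥ v)| ≤ α * Real.sqrt ((∑ i, u i) * (∑ i, v i))) →
      ∀ x : Fin n → ℝ, |x ⬝ᵥ (A *ᵥ x)| ≤ c * (α * (Real.log (d / α) + 1)) * (x ⬝ᵥ x) := by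
  obtain ⟨c₂, hc₂⟩ := h 1
  refine ⟨max c₂ 1, lt_of_lt_of_le zero_lt_one (le_max_right _ _), ?_⟩
  intro n A d α hsymm hα hαd hrow hdiag hdisc x
  have hlog : 0 ≤ α * (Real.log (d / α) + 1) := by
    refine mul_nonneg hα.le ?_
    have : 0 ≤ Real.log (d / α) := Real.log_nonneg ((one_le_div hα).mpr hαd)
    linarith
  have hxx : 0 ≤ x ⬝ᵥ x := by
    simpa [dotProduct] using Finset.sum_nonneg fun i _ => mul_self_nonneg (x i)
  have h1 := hc₂ n A d α hsymm hα hαd hrow (fun i => by simpa using hdiag i) hdisc x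
  refine h1.trans ?_
  exact mul_le_mul_of_nonneg_right (mul_le_mul_of_nonneg_right (le_max_left _ _) hlog) hxx

/-! ## Discharge: the fact is proved below (`BiluLinial2006_lemma_3_3_holds`)

The printed proof (pp. 502–505) is followed, with two bookkeeping simplifications that only move
the (untracked) absolute constant: (i) instead of first rounding `x` to a vector with entries
`±2^{-i}` (p. 503, a random rounding using the zero diagonal), the support of `x` is split
directly into the dyadic LEVEL SETS `S_k = {a : 2^{k-1} < |x_a| ≤ 2^k}` and the block
inequalities are proved for vectors with BOUNDED entries on a block (an `ℓ∞`–`ℓ₁` duality /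
sign-splitting step lands on sub-rectangles of `0/1` vectors, where the hypothesis — inequality
(4), p. 502 — applies); (ii) inequality (3) (`|uᵗAu| ≤ 2α‖u‖²` for `0/1` vectors, p. 502) is
obtained by averaging (4) over ALL bipartitions of the support rather than over the half-size
ones. The main count is the printed one (pp. 503–504): blocks `(k,l)` with
`|k-l| ≤ γ = ⌈log₂(d/α)⌉` cost `O(α(q_k+q_l))` each (`q_k = 4^k |S_k|`, `Σ q_k ≤ 4‖x‖²`), at most
`2γ+1` of them per level; the far blocks are summed through the row sums
(`Σ_{l<k-γ} 2^{k+l} M_{kl} ≤ 2^{-γ-1} d q_k`, ineq. (6)) and `2^{-γ} d ≤ α`; general diagonal by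
`A = B + D` (p. 505). With `log₂` the constant obtained is `100 + C` (`C` the diagonal constant),
whence `c₂ = 2(100 + max c₁ 0)` for the fact as stated with the natural logarithm
(`log₂ y + 1 ≤ 2(ln y + 1)` and `ln y ≤ log₂ y` for `y ≥ 1`). The hypothesis is used in the
rectangle form `|Σ_{a∈S,b∈T} A_{ab}| ≤ α√(|S||T|)` for disjoint `S, T` (= the printed
`0/1`-vector form with `u = 1_S`, `v = 1_T`: `BiluLinial2006.rectBound_of_forall_dotProduct`).
Unconditional user-facing forms follow the discharge: `BiluLinial2006_lemma_3_3_zero_diagonal`,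
`BiluLinial2006_lemma_3_3_unit_diagonal` (natural log, as in the fact),
`BiluLinial2006_lemma_3_3_explicit` / `BiluLinial2006_lemma_3_3_log2` (base 2, explicit constant;
the shape suggested by the requester), `BiluLinial2006_lemma_3_3_abs_eigenvalues_le`. -/

open Finset

namespace BiluLinial2006

variable {ι : Type*}

/-! #### Two elementary `ℓ∞`–`ℓ₁` duality steps (replace the random rounding of p. 503) -/

/-- If every partial sum of `c` over subsets of `S` is at most `β` in absolute value, then
`Σ_{a∈S} |c a| ≤ 2β` (split `S` by the sign of `c`). [folklore] -/
private theorem sum_abs_le_two_mul_of_forall_subset {S : Finset ι} {c : ι → ℝ} {β : ℝ}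
    (h : ∀ S' ⊆ S, |∑ a ∈ S', c a| ≤ β) : ∑ a ∈ S, |c a| ≤ 2 * β := by
  have hsplit : ∑ a ∈ S, |c a| =
      ∑ a ∈ S.filter (fun a => 0 ≤ c a), c a - ∑ a ∈ S.filter (fun a => ¬ 0 ≤ c a), c a := by
    rw [← sum_filter_add_sum_filter_not S (fun a => 0 ≤ c a) (fun a => |c a|), sub_eq_add_neg,
      ← sum_neg_distrib]
    congr 1
    · exact sum_congr rfl fun a ha => abs_of_nonneg (mem_filter.1 ha).2
    · exact sum_congr rfl fun a ha => abs_of_neg (lt_of_not_ge (mem_filter.1 ha).2)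
  rw [hsplit]
  have h1 := (abs_le.1 (h _ (filter_subset (fun a => 0 ≤ c a) S))).2
  have h2 := (abs_le.1 (h _ (filter_subset (fun a => ¬ 0 ≤ c a) S))).1
  linarith

/-- `|Σ_{a∈S} y a · c a| ≤ p · Σ_{a∈S} |c a|` when `|y a| ≤ p` on `S`. [folklore] -/
private theorem abs_sum_mul_le_of_abs_le {S : Finset ι} {y c : ι → ℝ} {p : ℝ}
    (hy : ∀ a ∈ S, |y a| ≤ p) : |∑ a ∈ S, y a * c a| ≤ p * ∑ a ∈ S, |c a| := by
  calc |∑ a ∈ S, y a * c a| ≤ ∑ a ∈ S, |y a * c a| := abs_sum_le_sum_abs _ _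
    _ = ∑ a ∈ S, |y a| * |c a| := by simp_rw [abs_mul]
    _ ≤ ∑ a ∈ S, p * |c a| :=
        sum_le_sum fun a ha => mul_le_mul_of_nonneg_right (hy a ha) (abs_nonneg _)
    _ = p * ∑ a ∈ S, |c a| := (mul_sum _ _ _).symm

/-! #### Block bounds from the disjoint-rectangle hypothesis -/

variable {A : Matrix ι ι ℝ} {α : ℝ}

/-- **Bilinear block bound for bounded vectors on disjoint supports** (replaces the
sign-vector inequality (5), p. 503, together with the rounding step): if `S ∩ T = ∅`,
`|y| ≤ p` on `S` and `|z| ≤ q` on `T`, then `|Σ_{a∈S,b∈T} A_{ab} y_a z_b| ≤ 4pq·α√(|S||T|)`.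
Proof: two `ℓ∞`–`ℓ₁` duality steps, each costing a factor `2` (sign splitting), landing on
sub-rectangles `S' × T'` of `S × T`, where the hypothesis applies. [cite: BiluLinial2006,
Lemma 3.3, proof p. 503 (ineq. (5))] -/
theorem abs_sum_sum_mul_mul_le_of_disjoint
    (hA : ∀ S T : Finset ι, Disjoint S T →
      |∑ a ∈ S, ∑ b ∈ T, A a b| ≤ α * Real.sqrt ((S.card : ℝ) * (T.card : ℝ))) (hα : 0 ≤ α)
    {S T : Finset ι} (hST : Disjoint S T) {y z : ι → ℝ} {p q : ℝ} (hp : 0 ≤ p) (hq : 0 ≤ q)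
    (hy : ∀ a ∈ S, |y a| ≤ p) (hz : ∀ b ∈ T, |z b| ≤ q) :
    |∑ a ∈ S, ∑ b ∈ T, A a b * y a * z b| ≤
      4 * p * q * (α * Real.sqrt ((S.card : ℝ) * (T.card : ℝ))) := by
  set X : ℝ := α * Real.sqrt ((S.card : ℝ) * (T.card : ℝ)) with hX
  -- partial sums in `a` of `Σ_b A a b z b` are bounded by `2 q X`
  have key : ∀ S' ⊆ S, |∑ a ∈ S', ∑ b ∈ T, A a b * z b| ≤ q * (2 * X) := by
    intro S' hS'
    have hswap : ∑ a ∈ S', ∑ b ∈ T, A a b * z b = ∑ b ∈ T, z b * ∑ a ∈ S', A a b := by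
      rw [sum_comm]
      refine sum_congr rfl fun b _ => ?_
      rw [mul_sum]
      exact sum_congr rfl fun a _ => mul_comm _ _
    rw [hswap]
    refine (abs_sum_mul_le_of_abs_le hz).trans (mul_le_mul_of_nonneg_left ?_ hq)
    refine sum_abs_le_two_mul_of_forall_subset fun T' hT' => ?_
    rw [sum_comm]
    refine (hA S' T' (hST.mono hS' hT')).trans ?_
    rw [hX]
    refine mul_le_mul_of_nonneg_left (Real.sqrt_le_sqrt ?_) hα
    exact mul_le_mul (by exact_mod_cast card_le_card hS') (by exact_mod_cast card_le_card hT')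
      (Nat.cast_nonneg _) (Nat.cast_nonneg _)
  have hrw : ∑ a ∈ S, ∑ b ∈ T, A a b * y a * z b = ∑ a ∈ S, y a * ∑ b ∈ T, A a b * z b := by
    refine sum_congr rfl fun a _ => ?_
    rw [mul_sum]
    exact sum_congr rfl fun b _ => by ring
  rw [hrw]
  refine (abs_sum_mul_le_of_abs_le hy).trans ?_
  have h2 := sum_abs_le_two_mul_of_forall_subset key
  calc p * ∑ a ∈ S, |∑ b ∈ T, A a b * z b| ≤ p * (2 * (q * (2 * X))) :=
        mul_le_mul_of_nonneg_left h2 hp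
    _ = 4 * p * q * X := by ring

/-! #### Averaging over all bipartitions (inequality (3), p. 502) -/

section Averaging

variable [DecidableEq ι]

/-- For `a ≠ b` in `S`, exactly `2^{|S|-2}` subsets `T ⊆ S` contain `a` and not `b`. [folklore] -/
private theorem card_filter_powerset_mem_not_mem {S : Finset ι} {a b : ι} (ha : a ∈ S) (hb : b ∈ S)
    (hab : a ≠ b) :
    ((S.powerset).filter (fun T => a ∈ T ∧ b ∉ T)).card = 2 ^ (S.card - 2) := by
  have hbS : b ∈ S.erase a := mem_erase.2 ⟨hab.symm, hb⟩
  have hS : (S.powerset).filter (fun T => a ∈ T ∧ b ∉ T) =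
      (((S.erase a).erase b).powerset).image (insert a) := by
    ext T
    simp only [mem_filter, mem_powerset, mem_image]
    constructor
    · rintro ⟨hTS, haT, hbT⟩
      refine ⟨T.erase a, fun x hx => ?_, insert_erase haT⟩
      rw [mem_erase] at hx
      refine mem_erase.2 ⟨?_, mem_erase.2 ⟨hx.1, hTS hx.2⟩⟩
      rintro rfl
      exact hbT hx.2
    · rintro ⟨T', hT', rfl⟩
      refine ⟨fun x hx => ?_, mem_insert_self a T', fun h => ?_⟩
      · rcases mem_insert.1 hx with rfl | hx
        · exact ha
        · exact mem_of_mem_erase (mem_of_mem_erase (hT' hx))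
      · rcases mem_insert.1 h with h | h
        · exact hab h.symm
        · exact (mem_erase.1 (hT' h)).1 rfl
  rw [hS, card_image_of_injOn, card_powerset, card_erase_of_mem hbS, card_erase_of_mem ha]
  · rfl
  · intro T₁ h₁ T₂ h₂ heq
    have ha₁ : a ∉ T₁ := fun h =>
      (mem_erase.1 (mem_of_mem_erase (mem_powerset.1 (mem_coe.1 h₁) h))).1 rfl
    have ha₂ : a ∉ T₂ := fun h =>
      (mem_erase.1 (mem_of_mem_erase (mem_powerset.1 (mem_coe.1 h₂) h))).1 rfl
    have := congrArg (fun U => Finset.erase U a) heq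
    simpa only [erase_insert ha₁, erase_insert ha₂] using this

/-- **Averaging identity over all bipartitions of `S`**: the sum over `T ⊆ S` of the
cross sums `Σ_{a∈T} Σ_{b∈S∖T} f a b` equals `2^{|S|-2}` times the off-diagonal sum
`Σ_{a∈S} Σ_{b∈S, b≠a} f a b` (each ordered pair `a ≠ b` is separated by exactly `2^{|S|-2}`
subsets). For `|S| ≤ 1` both sides are `0`. This is the averaging behind (3), p. 502 (there over
half-size subsets). [cite: BiluLinial2006, Lemma 3.3, proof p. 502 (ineq. (3)–(4))] -/
theorem sum_powerset_cross_eq (S : Finset ι) (f : ι → ι → ℝ) :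
    ∑ T ∈ S.powerset, ∑ a ∈ T, ∑ b ∈ S \ T, f a b =
      (2 : ℝ) ^ (S.card - 2) * ∑ a ∈ S, ∑ b ∈ S.erase a, f a b := by
  have h1 : ∀ T ∈ S.powerset, ∑ a ∈ T, ∑ b ∈ S \ T, f a b =
      ∑ a ∈ S, ∑ b ∈ S, if a ∈ T ∧ b ∉ T then f a b else 0 := by
    intro T hT
    have hTS := mem_powerset.1 hT
    symm
    calc ∑ a ∈ S, ∑ b ∈ S, (if a ∈ T ∧ b ∉ T then f a b else 0)
        = ∑ a ∈ S, (if a ∈ T then ∑ b ∈ S \ T, f a b else 0) := by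
          refine sum_congr rfl fun a _ => ?_
          split_ifs with haT
          · rw [sdiff_eq_filter, sum_filter]
            exact sum_congr rfl fun b _ => by simp [haT]
          · exact sum_eq_zero fun b _ => by simp [haT]
      _ = ∑ a ∈ S ∩ T, ∑ b ∈ S \ T, f a b := by rw [← sum_ite_mem]
      _ = ∑ a ∈ T, ∑ b ∈ S \ T, f a b := by rw [inter_eq_right.2 hTS]
  rw [sum_congr rfl h1, sum_comm]
  rw [mul_sum]
  refine sum_congr rfl fun a ha => ?_
  rw [sum_comm, mul_sum]
  -- now: Σ_{b∈S} Σ_{T} ite = Σ_{b ∈ S.erase a} 2^(|S|-2) f a b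
  have h2 : ∀ b ∈ S, ∑ T ∈ S.powerset, (if a ∈ T ∧ b ∉ T then f a b else 0) =
      (((S.powerset).filter (fun T => a ∈ T ∧ b ∉ T)).card : ℝ) * f a b := by
    intro b _
    rw [← sum_filter, sum_const, nsmul_eq_mul]
  rw [sum_congr rfl h2, ← sum_erase S (a := a)]
  · refine sum_congr rfl fun b hb => ?_
    rw [card_filter_powerset_mem_not_mem ha (mem_of_mem_erase hb) (ne_of_mem_erase hb).symm]
    push_cast
    ring
  · have : (S.powerset).filter (fun T => a ∈ T ∧ a ∉ T) = ∅ :=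
      filter_eq_empty_iff.2 fun T _ h => h.2 h.1
    rw [this, card_empty, Nat.cast_zero, zero_mul]

/-- **Same-support block bound** (the weighted form of inequality (3), p. 502): if `|y| ≤ p` on
`S` then the OFF-DIAGONAL quadratic sum satisfies
`|Σ_{a∈S} Σ_{b∈S, b≠a} A_{ab} y_a y_b| ≤ 8 p² α |S|`. Proof: average the bilinear block bound
over all bipartitions `S = T ⊔ (S ∖ T)` (`sum_powerset_cross_eq`), using
`√(|T|·|S∖T|) ≤ |S|/2`. [cite: BiluLinial2006, Lemma 3.3, proof p. 502 (ineq. (3))] -/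
theorem abs_sum_sum_erase_mul_mul_le
    (hA : ∀ S T : Finset ι, Disjoint S T →
      |∑ a ∈ S, ∑ b ∈ T, A a b| ≤ α * Real.sqrt ((S.card : ℝ) * (T.card : ℝ))) (hα : 0 ≤ α)
    {S : Finset ι} {y : ι → ℝ} {p : ℝ} (hp : 0 ≤ p) (hy : ∀ a ∈ S, |y a| ≤ p) :
    |∑ a ∈ S, ∑ b ∈ S.erase a, A a b * y a * y b| ≤ 8 * p ^ 2 * (α * S.card) := by
  have hid := sum_powerset_cross_eq S (fun a b => A a b * y a * y b)
  -- each cross term is at most `2 p² α |S|`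
  have hcross : ∀ T ∈ S.powerset,
      |∑ a ∈ T, ∑ b ∈ S \ T, A a b * y a * y b| ≤ 2 * p ^ 2 * (α * S.card) := by
    intro T hT
    have hTS := mem_powerset.1 hT
    refine (abs_sum_sum_mul_mul_le_of_disjoint hA hα disjoint_sdiff hp hp
      (fun a ha => hy a (hTS ha)) (fun b hb => hy b (sdiff_subset hb))).trans ?_
    have hsq : Real.sqrt ((T.card : ℝ) * ((S \ T).card : ℝ)) ≤ (S.card : ℝ) / 2 := by
      rw [show ((S \ T).card : ℝ) = S.card - T.card by
        rw [card_sdiff_of_subset hTS, Nat.cast_sub (card_le_card hTS)]]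
      refine Real.sqrt_le_iff.2 ⟨by positivity, ?_⟩
      nlinarith [sq_nonneg ((S.card : ℝ) - 2 * T.card)]
    calc 4 * p * p * (α * Real.sqrt ((T.card : ℝ) * ((S \ T).card : ℝ)))
        ≤ 4 * p * p * (α * ((S.card : ℝ) / 2)) := by gcongr
      _ = 2 * p ^ 2 * (α * S.card) := by ring
  have hsum : |∑ T ∈ S.powerset, ∑ a ∈ T, ∑ b ∈ S \ T, A a b * y a * y b| ≤
      (2 : ℝ) ^ S.card * (2 * p ^ 2 * (α * S.card)) := by
    refine (abs_sum_le_sum_abs _ _).trans ?_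
    have := sum_le_sum hcross
    refine this.trans ?_
    rw [sum_const, card_powerset, nsmul_eq_mul]
    push_cast
    rfl
  rw [hid, abs_mul, abs_of_pos (by positivity)] at hsum
  have hpow : (2 : ℝ) ^ S.card ≤ 4 * 2 ^ (S.card - 2) := by
    calc (2 : ℝ) ^ S.card ≤ 2 ^ (S.card - 2 + 2) :=
          pow_le_pow_right₀ (by norm_num) le_tsub_add
      _ = 4 * 2 ^ (S.card - 2) := by rw [pow_add]; ring
  have h22 : (0 : ℝ) < 2 ^ (S.card - 2) := by positivity
  have hnn : 0 ≤ 2 * p ^ 2 * (α * S.card) := by positivity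
  have h3 : (2 : ℝ) ^ (S.card - 2) * |∑ a ∈ S, ∑ b ∈ S.erase a, A a b * y a * y b| ≤
      (2 : ℝ) ^ (S.card - 2) * (4 * (2 * p ^ 2 * (α * S.card))) :=
    calc _ ≤ (2 : ℝ) ^ S.card * (2 * p ^ 2 * (α * S.card)) := hsum
      _ ≤ (4 * 2 ^ (S.card - 2)) * (2 * p ^ 2 * (α * S.card)) :=
          mul_le_mul_of_nonneg_right hpow hnn
      _ = (2 : ℝ) ^ (S.card - 2) * (4 * (2 * p ^ 2 * (α * S.card))) := by ring
  calc |∑ a ∈ S, ∑ b ∈ S.erase a, A a b * y a * y b| ≤ 4 * (2 * p ^ 2 * (α * S.card)) :=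
        le_of_mul_le_mul_left h3 h22
    _ = 8 * p ^ 2 * (α * S.card) := by ring

end Averaging


/-! #### The dyadic-level argument (pp. 503–504) -/

section Main

variable [Fintype ι] [DecidableEq ι]

/-- **[BiluLinial2006, Lemma 3.3], zero-diagonal case, `Finset`-hypothesis form, explicit
constant.** If `A` is real symmetric with zero diagonal, every row has `ℓ₁`-norm `≤ d`,
`0 < α ≤ d`, and `|Σ_{S×T} A| ≤ α√(|S||T|)` for all disjoint `S, T`, then
`|Σ_{a,b} A_{ab} x_a x_b| ≤ 100·α(log₂(d/α)+1)·Σ_a x_a²` for every `x`.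
Proof (pp. 503–504 with the rounding replaced by level sets): split `supp x` into dyadic
levels `S_k = {a : 2^{k-1} < |x_a| ≤ 2^k}`, `q_k = 4^k |S_k|`, `Q = Σ q_k ≤ 4‖x‖²`; a block
`(k,l)` with `|k-l| ≤ γ := ⌈log₂(d/α)⌉` is at most `4α(q_k+q_l)` (bilinear / same-support block
bounds + AM–GM), and there are `≤ 2γ+1` such `l` per `k`; the far blocks are summed through the
row sums: `Σ_{l < k-γ} 2^{k+l} M_{kl} ≤ 2^{-γ-1} d q_k`, and `2^{-γ} d ≤ α`. Total
`(16γ+9)αQ ≤ 100·α(log₂(d/α)+1)‖x‖²`. [cite: BiluLinial2006, Lemma 3.3 (proof pp. 502–504)] -/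
theorem abs_sum_sum_mul_mul_le_of_diag_eq_zero (hsymm : A.IsSymm) (hdiag : ∀ i, A i i = 0)
    {d : ℝ} (hα : 0 < α) (hαd : α ≤ d) (hrow : ∀ i, ∑ j, |A i j| ≤ d)
    (hA : ∀ S T : Finset ι, Disjoint S T →
      |∑ a ∈ S, ∑ b ∈ T, A a b| ≤ α * Real.sqrt ((S.card : ℝ) * (T.card : ℝ))) (x : ι → ℝ) :
    |∑ a, ∑ b, A a b * x a * x b| ≤ 100 * (α * (Real.logb 2 (d / α) + 1)) * ∑ a, x a ^ 2 := by
  /- constants -/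
  have hd : 0 < d := hα.trans_le hαd
  have hdα : 1 ≤ d / α := by rw [le_div_iff₀ hα, one_mul]; exact hαd
  have hlogb : 0 ≤ Real.logb 2 (d / α) := Real.logb_nonneg one_lt_two hdα
  set L : ℝ := Real.logb 2 (d / α) + 1 with hL
  have hL1 : 1 ≤ L := by rw [hL]; linarith
  obtain ⟨γ, hγ⟩ : ∃ γ : ℕ, γ = ⌈Real.logb 2 (d / α)⌉₊ := ⟨_, rfl⟩
  have hγL : (γ : ℝ) ≤ L := by rw [hγ, hL]; exact (Nat.ceil_lt_add_one hlogb).le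
  have h2γ : d / α ≤ (2 : ℝ) ^ γ := by
    rw [hγ]
    calc d / α = (2 : ℝ) ^ Real.logb 2 (d / α) :=
          (Real.rpow_logb two_pos (by norm_num) (by positivity)).symm
      _ ≤ (2 : ℝ) ^ ((⌈Real.logb 2 (d / α)⌉₊ : ℕ) : ℝ) :=
          Real.rpow_le_rpow_of_exponent_le one_le_two (Nat.le_ceil _)
      _ = _ := Real.rpow_natCast 2 _
  have hεd : d * (2 : ℝ) ^ (-(γ : ℤ)) ≤ α := by
    rw [_root_.zpow_neg, zpow_natCast, ← div_eq_mul_inv, div_le_iff₀ (by positivity)]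
    calc d = (d / α) * α := by field_simp
      _ ≤ (2 : ℝ) ^ γ * α := mul_le_mul_of_nonneg_right h2γ hα.le
      _ = α * 2 ^ γ := mul_comm _ _
  /- support, levels, blocks -/
  obtain ⟨P, hP⟩ : ∃ P : Finset ι, P = univ.filter (fun a => x a ≠ 0) := ⟨_, rfl⟩
  obtain ⟨lv, hlv⟩ : ∃ lv : ι → ℤ, lv = fun a => Int.clog 2 |x a| := ⟨_, rfl⟩
  obtain ⟨K, hK⟩ : ∃ K : Finset ℤ, K = P.image lv := ⟨_, rfl⟩
  obtain ⟨S, hS⟩ : ∃ S : ℤ → Finset ι, S = fun k => P.filter (fun a => lv a = k) := ⟨_, rfl⟩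
  obtain ⟨w, hw⟩ : ∃ w : ℤ → ℝ, w = fun k => (2 : ℝ) ^ k := ⟨_, rfl⟩
  obtain ⟨q, hq⟩ : ∃ q : ℤ → ℝ, q = fun k => w k ^ 2 * ((S k).card : ℝ) := ⟨_, rfl⟩
  obtain ⟨Q, hQ⟩ : ∃ Q : ℝ, Q = ∑ k ∈ K, q k := ⟨_, rfl⟩
  obtain ⟨B, hB⟩ : ∃ B : ℤ → ℤ → ℝ,
      B = fun k l => ∑ a ∈ S k, ∑ b ∈ S l, A a b * x a * x b := ⟨_, rfl⟩
  obtain ⟨M, hM⟩ : ∃ M : ℤ → ℤ → ℝ, M = fun k l => ∑ a ∈ S k, ∑ b ∈ S l, |A a b| := ⟨_, rfl⟩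
  have hmemP : ∀ a, a ∈ P ↔ x a ≠ 0 := fun a => by rw [hP]; simp
  have hmemS : ∀ k a, a ∈ S k ↔ a ∈ P ∧ lv a = k := fun k a => by rw [hS]; simp
  have hSdisj : ∀ k l, k ≠ l → Disjoint (S k) (S l) := by
    intro k l hkl
    rw [Finset.disjoint_left]
    intro a hak hal
    exact hkl (((hmemS k a).1 hak).2.symm.trans ((hmemS l a).1 hal).2)
  have hmaps : ∀ a ∈ P, lv a ∈ K := fun a ha => by rw [hK]; exact mem_image_of_mem lv ha
  have hfiber : ∀ g : ι → ℝ, ∑ a ∈ P, g a = ∑ k ∈ K, ∑ a ∈ S k, g a := by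
    intro g
    rw [hS]
    exact (sum_fiberwise_of_maps_to hmaps g).symm
  have hw_pos : ∀ k, 0 < w k := fun k => by rw [hw]; exact zpow_pos two_pos k
  have hxle : ∀ k, ∀ a ∈ S k, |x a| ≤ w k := by
    intro k a ha
    obtain ⟨-, hk⟩ := (hmemS k a).1 ha
    have h1 : |x a| ≤ ((2 : ℕ) : ℝ) ^ (Int.clog 2 |x a|) := Int.self_le_zpow_clog (by norm_num) |x a|
    rw [Nat.cast_ofNat] at h1
    rw [hw, ← hk, hlv]
    exact h1
  have hxgt : ∀ k, ∀ a ∈ S k, w k < 2 * |x a| := by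
    intro k a ha
    obtain ⟨haP, hk⟩ := (hmemS k a).1 ha
    have hxa : 0 < |x a| := abs_pos.2 ((hmemP a).1 haP)
    have h1 : ((2 : ℕ) : ℝ) ^ (Int.clog 2 |x a| - 1) < |x a| :=
      Int.zpow_pred_clog_lt_self (by norm_num) hxa
    rw [Nat.cast_ofNat, zpow_sub_one₀ two_ne_zero] at h1
    have h2 : (2 : ℝ) ^ (Int.clog 2 |x a|) < 2 * |x a| := by linarith
    rw [hw, ← hk, hlv]
    exact h2
  have hq_nn : ∀ k, 0 ≤ q k := fun k => by rw [hq]; positivity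
  have hQ_nn : 0 ≤ Q := by rw [hQ]; exact sum_nonneg fun k _ => hq_nn k
  have hq_le : ∀ k, q k ≤ 4 * ∑ a ∈ S k, x a ^ 2 := by
    intro k
    have h1 : ∑ a ∈ S k, w k ^ 2 ≤ ∑ a ∈ S k, 4 * x a ^ 2 := sum_le_sum fun a ha => by
      have h2 : w k ^ 2 ≤ (2 * |x a|) ^ 2 := pow_le_pow_left₀ (hw_pos k).le (hxgt k a ha).le 2
      rw [mul_pow, sq_abs] at h2
      linarith
    rw [sum_const, nsmul_eq_mul, ← mul_sum] at h1
    rw [hq]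
    dsimp only
    linarith
  have hQ_le : Q ≤ 4 * ∑ a, x a ^ 2 := by
    rw [hQ]
    calc ∑ k ∈ K, q k ≤ ∑ k ∈ K, 4 * ∑ a ∈ S k, x a ^ 2 := sum_le_sum fun k _ => hq_le k
      _ = 4 * ∑ a ∈ P, x a ^ 2 := by rw [← mul_sum, ← hfiber]
      _ ≤ 4 * ∑ a, x a ^ 2 :=
          mul_le_mul_of_nonneg_left (sum_le_univ_sum_of_nonneg fun a => sq_nonneg (x a))
            (by norm_num)
  /- the quadratic form as a sum of blocks -/
  have hquad : ∑ a, ∑ b, A a b * x a * x b = ∑ k ∈ K, ∑ l ∈ K, B k l := by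
    have e1 : ∑ a, ∑ b, A a b * x a * x b = ∑ a ∈ P, ∑ b ∈ P, A a b * x a * x b := by
      symm
      refine (sum_subset (subset_univ P) fun a _ ha => ?_).trans
        (sum_congr rfl fun a _ => sum_subset (subset_univ P) fun b _ hb => ?_)
      · have : x a = 0 := by simpa [hmemP] using ha
        simp [this]
      · have : x b = 0 := by simpa [hmemP] using hb
        simp [this]
    rw [e1, hfiber]
    refine sum_congr rfl fun k _ => ?_
    rw [hB]
    calc ∑ a ∈ S k, ∑ b ∈ P, A a b * x a * x b
        = ∑ a ∈ S k, ∑ l ∈ K, ∑ b ∈ S l, A a b * x a * x b :=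
          sum_congr rfl fun a _ => hfiber _
      _ = ∑ l ∈ K, ∑ a ∈ S k, ∑ b ∈ S l, A a b * x a * x b := sum_comm
  /- block bounds -/
  have hB_diag : ∀ k, |B k k| ≤ 8 * (α * q k) := by
    intro k
    rw [hB, hq]
    have e : ∑ a ∈ S k, ∑ b ∈ S k, A a b * x a * x b =
        ∑ a ∈ S k, ∑ b ∈ (S k).erase a, A a b * x a * x b := by
      refine sum_congr rfl fun a _ => (sum_erase (S k) ?_).symm
      rw [hdiag a, zero_mul, zero_mul]
    dsimp only
    rw [e]
    calc |∑ a ∈ S k, ∑ b ∈ (S k).erase a, A a b * x a * x b|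
        ≤ 8 * w k ^ 2 * (α * (S k).card) :=
          abs_sum_sum_erase_mul_mul_le hA hα.le (hw_pos k).le (hxle k)
      _ = 8 * (α * (w k ^ 2 * (S k).card)) := by ring
  have hB_off : ∀ k l, k ≠ l → |B k l| ≤ 2 * α * (q k + q l) := by
    intro k l hkl
    rw [hB, hq]
    dsimp only
    calc |∑ a ∈ S k, ∑ b ∈ S l, A a b * x a * x b|
        ≤ 4 * w k * w l * (α * Real.sqrt (((S k).card : ℝ) * ((S l).card : ℝ))) :=
          abs_sum_sum_mul_mul_le_of_disjoint hA hα.le (hSdisj k l hkl) (hw_pos k).le (hw_pos l).le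
            (hxle k) (hxle l)
      _ = 2 * α * (2 * (w k * Real.sqrt ((S k).card : ℝ)) * (w l * Real.sqrt ((S l).card : ℝ))) := by
          rw [Real.sqrt_mul (Nat.cast_nonneg _)]; ring
      _ ≤ 2 * α * ((w k * Real.sqrt ((S k).card : ℝ)) ^ 2 + (w l * Real.sqrt ((S l).card : ℝ)) ^ 2) :=
          mul_le_mul_of_nonneg_left (two_mul_le_add_sq _ _) (by positivity)
      _ = 2 * α * (w k ^ 2 * (S k).card + w l ^ 2 * (S l).card) := by
          rw [mul_pow, mul_pow, Real.sq_sqrt (Nat.cast_nonneg _), Real.sq_sqrt (Nat.cast_nonneg _)]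
  have hM_nn : ∀ k l, 0 ≤ M k l := fun k l => by
    rw [hM]; exact sum_nonneg fun a _ => sum_nonneg fun b _ => abs_nonneg _
  have hB_M : ∀ k l, |B k l| ≤ w k * w l * M k l := by
    intro k l
    rw [hB, hM]
    dsimp only
    refine (abs_sum_le_sum_abs _ _).trans ?_
    rw [mul_sum]
    refine sum_le_sum fun a ha => (abs_sum_le_sum_abs _ _).trans ?_
    rw [mul_sum]
    refine sum_le_sum fun b hb => ?_
    rw [abs_mul, abs_mul]
    calc |A a b| * |x a| * |x b| ≤ |A a b| * w k * w l :=
          mul_le_mul (mul_le_mul_of_nonneg_left (hxle k a ha) (abs_nonneg _)) (hxle l b hb)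
            (abs_nonneg _) (mul_nonneg (abs_nonneg _) (hw_pos k).le)
      _ = w k * w l * |A a b| := by ring
  have hM_symm : ∀ k l, M k l = M l k := by
    intro k l
    rw [hM]
    dsimp only
    rw [sum_comm]
    exact sum_congr rfl fun b _ => sum_congr rfl fun a _ => by rw [hsymm.apply a b]
  have hM_row : ∀ k, ∑ l ∈ K, M k l ≤ d * (S k).card := by
    intro k
    rw [hM]
    dsimp only
    rw [sum_comm]
    calc ∑ a ∈ S k, ∑ l ∈ K, ∑ b ∈ S l, |A a b| = ∑ a ∈ S k, ∑ b ∈ P, |A a b| :=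
          sum_congr rfl fun a _ => (hfiber _).symm
      _ ≤ ∑ a ∈ S k, ∑ b, |A a b| :=
          sum_le_sum fun a _ => sum_le_univ_sum_of_nonneg fun b => abs_nonneg _
      _ ≤ ∑ a ∈ S k, d := sum_le_sum fun a _ => hrow a
      _ = d * (S k).card := by rw [sum_const, nsmul_eq_mul, mul_comm]
  /- near / far majorants -/
  obtain ⟨N, hN⟩ : ∃ N : ℤ → ℤ → ℝ,
      N = fun k l => if |k - l| ≤ (γ : ℤ) then 4 * α * q k else 0 := ⟨_, rfl⟩
  obtain ⟨F, hF⟩ : ∃ F : ℤ → ℤ → ℝ,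
      F = fun k l : ℤ => if l + (γ : ℤ) < k then w k * w l * M k l else 0 := ⟨_, rfl⟩
  have hN_nn : ∀ k l, 0 ≤ N k l := fun k l => by
    rw [hN]
    dsimp only
    split_ifs
    · exact mul_nonneg (mul_nonneg (by norm_num) hα.le) (hq_nn k)
    · exact le_rfl
  have hF_nn : ∀ k l, 0 ≤ F k l := fun k l => by
    rw [hF]
    dsimp only
    split_ifs
    · exact mul_nonneg (mul_nonneg (hw_pos k).le (hw_pos l).le) (hM_nn k l)
    · exact le_rfl
  have hterm : ∀ k l, |B k l| ≤ N k l + N l k + (F k l + F l k) := by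
    intro k l
    by_cases hnear : |k - l| ≤ (γ : ℤ)
    · have hnear' : |l - k| ≤ (γ : ℤ) := by rwa [abs_sub_comm]
      have e1 : N k l = 4 * α * q k := by rw [hN]; exact if_pos hnear
      have e2 : N l k = 4 * α * q l := by rw [hN]; exact if_pos hnear'
      have hb : |B k l| ≤ 4 * α * (q k + q l) := by
        by_cases hkl : k = l
        · subst hkl
          have := hB_diag k
          linarith [hq_nn k]
        · have := hB_off k l hkl
          nlinarith [hq_nn k, hq_nn l, hα.le]
      linarith [hF_nn k l, hF_nn l k]
    · rw [not_le] at hnear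
      rcases lt_abs.1 hnear with h | h
      · have e : F k l = w k * w l * M k l := by
          rw [hF]; exact if_pos (by linarith)
        linarith [hB_M k l, hN_nn k l, hN_nn l k, hF_nn l k]
      · have e : F l k = w l * w k * M l k := by
          rw [hF]; exact if_pos (by linarith)
        rw [hM_symm l k, mul_comm (w l) (w k)] at e
        linarith [hB_M k l, hN_nn k l, hN_nn l k, hF_nn k l]
  /- summing the near majorant: at most `2γ+1` levels `l` are near a given `k` -/
  have hcardnear : ∀ k, (((K.filter (fun l => |k - l| ≤ (γ : ℤ))).card : ℕ) : ℝ) ≤ 2 * γ + 1 := by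
    intro k
    have hsub : K.filter (fun l => |k - l| ≤ (γ : ℤ)) ⊆ Finset.Icc (k - γ) (k + γ) := by
      intro l hl
      have h := (mem_filter.1 hl).2
      rw [abs_le] at h
      rw [Finset.mem_Icc]
      constructor <;> linarith [h.1, h.2]
    have h := card_le_card hsub
    rw [Int.card_Icc] at h
    have e : (k + γ + 1 - (k - γ)).toNat = 2 * γ + 1 := by omega
    rw [e] at h
    exact_mod_cast h
  have hNsum : ∑ k ∈ K, ∑ l ∈ K, N k l ≤ 4 * α * (2 * γ + 1) * Q := by
    rw [hN, hQ]
    dsimp only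
    calc ∑ k ∈ K, ∑ l ∈ K, (if |k - l| ≤ (γ : ℤ) then 4 * α * q k else 0)
        = ∑ k ∈ K, 4 * α * q k * (((K.filter (fun l => |k - l| ≤ (γ : ℤ))).card : ℕ) : ℝ) := by
          refine sum_congr rfl fun k _ => ?_
          rw [← sum_filter, sum_const, nsmul_eq_mul, mul_comm]
      _ ≤ ∑ k ∈ K, 4 * α * q k * (2 * γ + 1) :=
          sum_le_sum fun k _ => mul_le_mul_of_nonneg_left (hcardnear k)
            (mul_nonneg (mul_nonneg (by norm_num) hα.le) (hq_nn k))
      _ = 4 * α * (2 * γ + 1) * ∑ k ∈ K, q k := by rw [mul_sum]; exact sum_congr rfl fun k _ => by ring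
  /- summing the far majorant through the row sums -/
  have hFsum : ∑ k ∈ K, ∑ l ∈ K, F k l ≤ d * (2 : ℝ) ^ (-(γ : ℤ)) / 2 * Q := by
    rw [hF, hQ]
    dsimp only
    have hwl : ∀ k l : ℤ, l + γ < k → w l ≤ w k * (2 : ℝ) ^ (-(γ : ℤ) - 1) := by
      intro k l h
      rw [hw]
      dsimp only
      rw [← zpow_add₀ (two_ne_zero)]
      exact zpow_le_zpow_right₀ one_le_two (by linarith)
    calc ∑ k ∈ K, ∑ l ∈ K, (if l + (γ : ℤ) < k then w k * w l * M k l else 0)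
        ≤ ∑ k ∈ K, ∑ l ∈ K, w k * (w k * (2 : ℝ) ^ (-(γ : ℤ) - 1)) * M k l := by
          refine sum_le_sum fun k _ => sum_le_sum fun l _ => ?_
          split_ifs with h
          · exact mul_le_mul_of_nonneg_right
              (mul_le_mul_of_nonneg_left (hwl k l h) (hw_pos k).le) (hM_nn k l)
          · exact mul_nonneg (mul_nonneg (hw_pos k).le
              (mul_nonneg (hw_pos k).le (zpow_nonneg (by norm_num) _))) (hM_nn k l)
      _ = ∑ k ∈ K, w k ^ 2 * (2 : ℝ) ^ (-(γ : ℤ) - 1) * ∑ l ∈ K, M k l := by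
          refine sum_congr rfl fun k _ => ?_
          rw [mul_sum]
          exact sum_congr rfl fun l _ => by ring
      _ ≤ ∑ k ∈ K, w k ^ 2 * (2 : ℝ) ^ (-(γ : ℤ) - 1) * (d * (S k).card) :=
          sum_le_sum fun k _ => mul_le_mul_of_nonneg_left (hM_row k) (by positivity)
      _ = d * (2 : ℝ) ^ (-(γ : ℤ)) / 2 * ∑ k ∈ K, q k := by
          rw [mul_sum]
          refine sum_congr rfl fun k _ => ?_
          rw [hq]
          dsimp only
          rw [zpow_sub_one₀ two_ne_zero]
          ring
  /- assembling -/
  have htotal : |∑ a, ∑ b, A a b * x a * x b| ≤ (16 * γ + 9) * α * Q := by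
    rw [hquad]
    have e1 : ∑ k ∈ K, ∑ l ∈ K, N l k = ∑ k ∈ K, ∑ l ∈ K, N k l := sum_comm
    have e2 : ∑ k ∈ K, ∑ l ∈ K, F l k = ∑ k ∈ K, ∑ l ∈ K, F k l := sum_comm
    have hdQ : d * (2 : ℝ) ^ (-(γ : ℤ)) * Q ≤ α * Q := mul_le_mul_of_nonneg_right hεd hQ_nn
    calc |∑ k ∈ K, ∑ l ∈ K, B k l| ≤ ∑ k ∈ K, ∑ l ∈ K, |B k l| :=
          (abs_sum_le_sum_abs _ _).trans (sum_le_sum fun k _ => abs_sum_le_sum_abs _ _)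
      _ ≤ ∑ k ∈ K, ∑ l ∈ K, (N k l + N l k + (F k l + F l k)) :=
          sum_le_sum fun k _ => sum_le_sum fun l _ => hterm k l
      _ = 2 * ∑ k ∈ K, ∑ l ∈ K, N k l + 2 * ∑ k ∈ K, ∑ l ∈ K, F k l := by
          simp only [sum_add_distrib]
          rw [e1, e2]
          ring
      _ ≤ 2 * (4 * α * (2 * γ + 1) * Q) + 2 * (d * (2 : ℝ) ^ (-(γ : ℤ)) / 2 * Q) := by
          linarith [hNsum, hFsum]
      _ ≤ (16 * γ + 9) * α * Q := by linarith [hdQ]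
  have hsum_nn : 0 ≤ ∑ a, x a ^ 2 := sum_nonneg fun a _ => sq_nonneg _
  have hc : (16 * (γ : ℝ) + 9) * 4 ≤ 100 * L := by linarith
  calc |∑ a, ∑ b, A a b * x a * x b| ≤ (16 * γ + 9) * α * Q := htotal
    _ ≤ (16 * γ + 9) * α * (4 * ∑ a, x a ^ 2) :=
        mul_le_mul_of_nonneg_left hQ_le (by positivity)
    _ = (16 * (γ : ℝ) + 9) * 4 * (α * ∑ a, x a ^ 2) := by ring
    _ ≤ 100 * L * (α * ∑ a, x a ^ 2) := mul_le_mul_of_nonneg_right hc (by positivity)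
    _ = 100 * (α * L) * ∑ a, x a ^ 2 := by ring

end Main


/-! #### From the zero-diagonal `Finset` form to the printed statement -/

section General

variable [Fintype ι] [DecidableEq ι]

/-! #### The printed `0/1`-vector hypothesis in rectangle form -/

/-- **The printed hypothesis implies the rectangle form**: if `|uᵗAv| ≤ α‖u‖‖v‖` for all
`u, v ∈ {0,1}^ι` with disjoint supports (`‖u‖² = Σ uᵢ`), then for all disjoint `S, T ⊆ ι`,
`|Σ_{a∈S} Σ_{b∈T} A a b| ≤ α √(|S|·|T|)` (take `u = 1_S`, `v = 1_T`; this is inequality (4) of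
the printed proof). [cite: BiluLinial2006, Lemma 3.3 (proof, eq. (4) p. 502)] -/
theorem rectBound_of_forall_dotProduct {A : Matrix ι ι ℝ} {α : ℝ}
    (h : ∀ u v : ι → ℝ, (∀ i, u i = 0 ∨ u i = 1) → (∀ i, v i = 0 ∨ v i = 1) →
        (∀ i, u i = 0 ∨ v i = 0) →
        |u ⬝ᵥ (A *ᵥ v)| ≤ α * Real.sqrt ((∑ i, u i) * (∑ i, v i))) :
    ∀ S T : Finset ι, Disjoint S T →
      |∑ a ∈ S, ∑ b ∈ T, A a b| ≤ α * Real.sqrt ((S.card : ℝ) * (T.card : ℝ)) := by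
  intro S T hST
  have hu : ∀ i, (if i ∈ S then (1 : ℝ) else 0) = 0 ∨ (if i ∈ S then (1 : ℝ) else 0) = 1 :=
    fun i => by by_cases hi : i ∈ S <;> simp [hi]
  have hv : ∀ i, (if i ∈ T then (1 : ℝ) else 0) = 0 ∨ (if i ∈ T then (1 : ℝ) else 0) = 1 :=
    fun i => by by_cases hi : i ∈ T <;> simp [hi]
  have huv : ∀ i, (if i ∈ S then (1 : ℝ) else 0) = 0 ∨ (if i ∈ T then (1 : ℝ) else 0) = 0 := by
    intro i
    by_cases hi : i ∈ S
    · exact Or.inr (by simp [Finset.disjoint_left.1 hST hi])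
    · exact Or.inl (by simp [hi])
  have h1 := h (fun i => if i ∈ S then 1 else 0) (fun i => if i ∈ T then 1 else 0) hu hv huv
  have e1 : (fun i => if i ∈ S then (1 : ℝ) else 0) ⬝ᵥ A *ᵥ (fun i => if i ∈ T then 1 else 0) =
      ∑ a ∈ S, ∑ b ∈ T, A a b := by
    simp only [dotProduct, Matrix.mulVec, ite_mul, one_mul, zero_mul, mul_ite, mul_one, mul_zero,
      sum_ite_mem, univ_inter]
  have e2 : ∑ i, (if i ∈ S then (1 : ℝ) else 0) = S.card := by
    rw [sum_ite_mem, univ_inter, sum_const, nsmul_eq_mul, mul_one]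
  have e3 : ∑ i, (if i ∈ T then (1 : ℝ) else 0) = T.card := by
    rw [sum_ite_mem, univ_inter, sum_const, nsmul_eq_mul, mul_one]
  rw [e1, e2, e3] at h1
  exact h1


omit [DecidableEq ι] in
/-- `xᵗAx = Σ_a Σ_b A_{ab} x_a x_b`. [folklore] -/
private theorem dotProduct_mulVec_eq_sum_sum (A : Matrix ι ι ℝ) (x : ι → ℝ) :
    x ⬝ᵥ A *ᵥ x = ∑ a, ∑ b, A a b * x a * x b := by
  simp only [dotProduct, Matrix.mulVec, mul_sum]
  exact sum_congr rfl fun a _ => sum_congr rfl fun b _ => by ring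

omit [DecidableEq ι] in
/-- `xᵗx = Σ_a x_a²`. [folklore] -/
private theorem dotProduct_self_eq_sum_sq' (x : ι → ℝ) : x ⬝ᵥ x = ∑ a, x a ^ 2 := by
  simp only [dotProduct, sq]

/-- **[BiluLinial2006, Lemma 3.3] with explicit constant, any finite index type, general
diagonal** (the reduction `A = B + D` of p. 504 bottom – p. 505 top): if `A` is real symmetric,
rows have `ℓ₁`-norm `≤ d`, `0 < α ≤ d`, `|Aᵢᵢ| ≤ C·α(log₂(d/α)+1)`, and the rectangle bound
`|Σ_{S×T} A| ≤ α√(|S||T|)` for disjoint `S, T`,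
then `|xᵗAx| ≤ (100 + C)·α(log₂(d/α)+1)·xᵗx`. [cite: BiluLinial2006, Lemma 3.3 (proof p. 505)] -/
theorem abs_dotProduct_mulVec_le (hsymm : A.IsSymm) {d C : ℝ} (hα : 0 < α) (hαd : α ≤ d)
    (hrow : ∀ i, ∑ j, |A i j| ≤ d)
    (hdiagC : ∀ i, |A i i| ≤ C * (α * (Real.logb 2 (d / α) + 1)))
    (hA : ∀ S T : Finset ι, Disjoint S T →
      |∑ a ∈ S, ∑ b ∈ T, A a b| ≤ α * Real.sqrt ((S.card : ℝ) * (T.card : ℝ))) (x : ι → ℝ) :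
    |x ⬝ᵥ A *ᵥ x| ≤ (100 + C) * (α * (Real.logb 2 (d / α) + 1)) * (x ⬝ᵥ x) := by
  set L : ℝ := Real.logb 2 (d / α) + 1 with hL
  obtain ⟨B, hB⟩ : ∃ B : Matrix ι ι ℝ, B = A - Matrix.diagonal (fun i => A i i) := ⟨_, rfl⟩
  have hBapply : ∀ a b, B a b = if a = b then 0 else A a b := by
    intro a b
    rw [hB, Matrix.sub_apply, Matrix.diagonal_apply]
    split_ifs with h
    · subst h; ring
    · ring
  have hBsymm : B.IsSymm := by
    refine Matrix.IsSymm.ext fun i j => ?_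
    rw [hBapply, hBapply]
    by_cases h : i = j
    · subst h; rfl
    · rw [if_neg h, if_neg (Ne.symm h), hsymm.apply]
  have hBdiag : ∀ i, B i i = 0 := fun i => by rw [hBapply, if_pos rfl]
  have hBrow : ∀ i, ∑ j, |B i j| ≤ d := by
    intro i
    refine le_trans (sum_le_sum fun j _ => ?_) (hrow i)
    rw [hBapply]
    split_ifs
    · rw [abs_zero]; exact abs_nonneg _
    · exact le_rfl
  have hBdisc : ∀ S T : Finset ι, Disjoint S T →
      |∑ a ∈ S, ∑ b ∈ T, B a b| ≤ α * Real.sqrt ((S.card : ℝ) * (T.card : ℝ)) := by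
    intro S T hST
    have e : ∑ a ∈ S, ∑ b ∈ T, B a b = ∑ a ∈ S, ∑ b ∈ T, A a b :=
      sum_congr rfl fun a ha => sum_congr rfl fun b hb => by
        rw [hBapply, if_neg]
        rintro rfl
        exact Finset.disjoint_left.1 hST ha hb
    rw [e]
    exact hA S T hST
  have hcore := abs_sum_sum_mul_mul_le_of_diag_eq_zero hBsymm hBdiag hα hαd hBrow hBdisc x
  have hsplit : x ⬝ᵥ A *ᵥ x = (∑ a, ∑ b, B a b * x a * x b) + ∑ a, A a a * x a ^ 2 := by
    rw [dotProduct_mulVec_eq_sum_sum, ← sum_add_distrib]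
    refine sum_congr rfl fun a _ => ?_
    have e : ∑ b, A a b * x a * x b =
        ∑ b, (B a b * x a * x b + if a = b then A a a * x a ^ 2 else 0) :=
      sum_congr rfl fun b _ => by
        rw [hBapply]
        split_ifs with h
        · subst h; ring
        · ring
    rw [e, sum_add_distrib, sum_ite_eq]
    simp
  have hdiagsum : |∑ a, A a a * x a ^ 2| ≤ C * (α * L) * ∑ a, x a ^ 2 := by
    refine (abs_sum_le_sum_abs _ _).trans ?_
    rw [mul_sum]
    refine sum_le_sum fun a _ => ?_
    rw [abs_mul, abs_of_nonneg (sq_nonneg (x a))]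
    exact mul_le_mul_of_nonneg_right (hdiagC a) (sq_nonneg _)
  rw [hsplit, dotProduct_self_eq_sum_sq']
  calc |(∑ a, ∑ b, B a b * x a * x b) + ∑ a, A a a * x a ^ 2|
      ≤ |∑ a, ∑ b, B a b * x a * x b| + |∑ a, A a a * x a ^ 2| := abs_add_le _ _
    _ ≤ 100 * (α * L) * ∑ a, x a ^ 2 + C * (α * L) * ∑ a, x a ^ 2 := add_le_add hcore hdiagsum
    _ = (100 + C) * (α * L) * ∑ a, x a ^ 2 := by ring

end General

end BiluLinial2006

/-! ### The discharge and unconditional forms -/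

/-- **Discharge of `BiluLinial2006_lemma_3_3`**: the named fact is a theorem (with
`c₂ = 2(100 + max c₁ 0)`). [cite: BiluLinial2006, Lemma 3.3 (p. 500; proof pp. 502–505)] -/
theorem BiluLinial2006_lemma_3_3_holds : BiluLinial2006_lemma_3_3 := by
  intro c₁
  refine ⟨2 * (100 + max c₁ 0), fun n A d α hsymm hα hαd hrow hdiag hdisc x => ?_⟩
  have hdα : 1 ≤ d / α := by rw [le_div_iff₀ hα, one_mul]; exact hαd
  have hln : 0 ≤ Real.log (d / α) := Real.log_nonneg hdα
  have hln2 : Real.log 2 ≤ 1 := Real.log_two_lt_d9.le.trans (by norm_num)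
  have hln2' : (1 : ℝ) / 2 ≤ Real.log 2 := le_trans (by norm_num) Real.log_two_gt_d9.le
  have hlog2pos : 0 < Real.log 2 := Real.log_pos one_lt_two
  have hlogb : Real.logb 2 (d / α) = Real.log (d / α) / Real.log 2 := rfl
  have hL_le : Real.log (d / α) + 1 ≤ Real.logb 2 (d / α) + 1 := by
    rw [hlogb, add_le_add_iff_right, le_div_iff₀ hlog2pos]
    exact mul_le_of_le_one_right hln hln2
  have hL_ge : Real.logb 2 (d / α) + 1 ≤ 2 * (Real.log (d / α) + 1) := by
    rw [hlogb]
    have : Real.log (d / α) / Real.log 2 ≤ 2 * Real.log (d / α) := by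
      rw [div_le_iff₀ hlog2pos]
      nlinarith
    linarith
  have hαL : 0 ≤ α * (Real.log (d / α) + 1) := mul_nonneg hα.le (by linarith)
  have hdiag' : ∀ i, |A i i| ≤ max c₁ 0 * (α * (Real.logb 2 (d / α) + 1)) := fun i =>
    (hdiag i).trans (mul_le_mul (le_max_left _ _) (mul_le_mul_of_nonneg_left hL_le hα.le) hαL
      (le_max_right _ _))
  have h := BiluLinial2006.abs_dotProduct_mulVec_le hsymm hα hαd hrow hdiag'
    (BiluLinial2006.rectBound_of_forall_dotProduct hdisc) x
  have hxx : 0 ≤ x ⬝ᵥ x := by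
    simpa [dotProduct] using Finset.sum_nonneg fun i _ => mul_self_nonneg (x i)
  have hc : (0 : ℝ) ≤ 100 + max c₁ 0 := by positivity
  calc |x ⬝ᵥ (A *ᵥ x)| ≤ (100 + max c₁ 0) * (α * (Real.logb 2 (d / α) + 1)) * (x ⬝ᵥ x) := h
    _ ≤ (100 + max c₁ 0) * (α * (2 * (Real.log (d / α) + 1))) * (x ⬝ᵥ x) :=
        mul_le_mul_of_nonneg_right
          (mul_le_mul_of_nonneg_left (mul_le_mul_of_nonneg_left hL_ge hα.le) hc) hxx
    _ = 2 * (100 + max c₁ 0) * (α * (Real.log (d / α) + 1)) * (x ⬝ᵥ x) := by ring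

/-- **Zero-diagonal form, unconditional** (`BiluLinial2006_lemma_3_3.zero_diagonal` fed with the
discharge): one absolute constant `c > 0` with `|xᵗAx| ≤ c·α(ln(d/α)+1)·xᵗx` for zero-diagonal
`A`. [cite: BiluLinial2006, Lemma 3.3 (p. 500)] -/
theorem BiluLinial2006_lemma_3_3_zero_diagonal :
    ∃ c : ℝ, 0 < c ∧ ∀ (n : ℕ) (A : Matrix (Fin n) (Fin n) ℝ) (d α : ℝ),
      A.IsSymm → 0 < α → α ≤ d →
      (∀ i, ∑ j, |A i j| ≤ d) →
      (∀ i, A i i = 0) →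
      (∀ u v : Fin n → ℝ, (∀ i, u i = 0 ∨ u i = 1) → (∀ i, v i = 0 ∨ v i = 1) →
          (∀ i, u i = 0 ∨ v i = 0) →
          |u ⬝ᵥ (A *ᵥ v)| ≤ α * Real.sqrt ((∑ i, u i) * (∑ i, v i))) →
      ∀ x : Fin n → ℝ, |x ⬝ᵥ (A *ᵥ x)| ≤ c * (α * (Real.log (d / α) + 1)) * (x ⬝ᵥ x) :=
  BiluLinial2006_lemma_3_3.zero_diagonal BiluLinial2006_lemma_3_3_holds

/-- **Unit diagonal-constant form, unconditional** (`BiluLinial2006_lemma_3_3.unit_diagonal` fed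
with the discharge). [cite: BiluLinial2006, Lemma 3.3 (p. 500)] -/
theorem BiluLinial2006_lemma_3_3_unit_diagonal :
    ∃ c : ℝ, 0 < c ∧ ∀ (n : ℕ) (A : Matrix (Fin n) (Fin n) ℝ) (d α : ℝ),
      A.IsSymm → 0 < α → α ≤ d →
      (∀ i, ∑ j, |A i j| ≤ d) →
      (∀ i, |A i i| ≤ α * (Real.log (d / α) + 1)) →
      (∀ u v : Fin n → ℝ, (∀ i, u i = 0 ∨ u i = 1) → (∀ i, v i = 0 ∨ v i = 1) →
          (∀ i, u i = 0 ∨ v i = 0) →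
          |u ⬝ᵥ (A *ᵥ v)| ≤ α * Real.sqrt ((∑ i, u i) * (∑ i, v i))) →
      ∀ x : Fin n → ℝ, |x ⬝ᵥ (A *ᵥ x)| ≤ c * (α * (Real.log (d / α) + 1)) * (x ⬝ᵥ x) :=
  BiluLinial2006_lemma_3_3.unit_diagonal BiluLinial2006_lemma_3_3_holds

/-- **Explicit-constant form over any finite index type, base-2 logarithm** (hypothesis in the
rectangle form; diagonal `|Aᵢᵢ| ≤ C·α(log₂(d/α)+1)`; conclusion with constant `100 + C`):
`|xᵗAx| ≤ (100 + C)·α(log₂(d/α)+1)·xᵗx`. The value `100` is an artefact of this formalisation's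
bookkeeping, not a printed constant (the paper prints `O(·)`).
[cite: BiluLinial2006, Lemma 3.3 (p. 500; proof pp. 502–505)] -/
theorem BiluLinial2006_lemma_3_3_explicit {ι : Type*} [Fintype ι] [DecidableEq ι]
    {A : Matrix ι ι ℝ} (hsymm : A.IsSymm) {d α C : ℝ} (hα : 0 < α) (hαd : α ≤ d)
    (hrow : ∀ i, ∑ j, |A i j| ≤ d)
    (hdiagC : ∀ i, |A i i| ≤ C * (α * (Real.logb 2 (d / α) + 1)))
    (hA : ∀ S T : Finset ι, Disjoint S T →
      |∑ a ∈ S, ∑ b ∈ T, A a b| ≤ α * Real.sqrt ((S.card : ℝ) * (T.card : ℝ)))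
    (x : ι → ℝ) :
    |x ⬝ᵥ (A *ᵥ x)| ≤ (100 + C) * (α * (Real.logb 2 (d / α) + 1)) * (x ⬝ᵥ x) :=
  BiluLinial2006.abs_dotProduct_mulVec_le hsymm hα hαd hrow hdiagC hA x

/-- **The base-2 shape suggested by the `P ≠ NP` cell's «sfm-bl» line** (conjecture leaf
`CandCutNormSigningFP`; diagonal bound `|Aᵢᵢ| ≤ α(log₂(d/α)+1)`, conclusion
`|xᵗAx| ≤ c·α·(log₂(d/α)+1)·xᵗx` with one absolute `c > 0`), unconditional.
[cite: BiluLinial2006, Lemma 3.3 (p. 500)] -/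
theorem BiluLinial2006_lemma_3_3_log2 :
    ∃ c : ℝ, 0 < c ∧ ∀ (n : ℕ) (A : Matrix (Fin n) (Fin n) ℝ) (d α : ℝ),
      A.IsSymm → 0 < α → α ≤ d →
      (∀ i, ∑ j, |A i j| ≤ d) →
      (∀ i, |A i i| ≤ α * (Real.logb 2 (d / α) + 1)) →
      (∀ u v : Fin n → ℝ, (∀ i, u i = 0 ∨ u i = 1) → (∀ i, v i = 0 ∨ v i = 1) →
          (∀ i, u i = 0 ∨ v i = 0) →
          |u ⬝ᵥ (A *ᵥ v)| ≤ α * Real.sqrt ((∑ i, u i) * (∑ i, v i))) →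
      ∀ x : Fin n → ℝ,
        |x ⬝ᵥ (A *ᵥ x)| ≤ c * α * (Real.logb 2 (d / α) + 1) * (x ⬝ᵥ x) := by
  refine ⟨101, by norm_num, fun n A d α hsymm hα hαd hrow hdiag hdisc x => ?_⟩
  have hdiag' : ∀ i, |A i i| ≤ 1 * (α * (Real.logb 2 (d / α) + 1)) := fun i => by
    rw [one_mul]; exact hdiag i
  have h := BiluLinial2006_lemma_3_3_explicit hsymm hα hαd hrow hdiag'
    (BiluLinial2006.rectBound_of_forall_dotProduct hdisc) x
  calc |x ⬝ᵥ (A *ᵥ x)| ≤ (100 + 1) * (α * (Real.logb 2 (d / α) + 1)) * (x ⬝ᵥ x) := h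
    _ = 101 * α * (Real.logb 2 (d / α) + 1) * (x ⬝ᵥ x) := by ring

/-- A unit vector of Mathlib's eigenvector basis of a real symmetric matrix has `bᵀb = 1`
(orthonormality read as a dot product over `ℝ`). [folklore] -/
private theorem eigenvectorBasis_dotProduct_self {n : ℕ} {A : Matrix (Fin n) (Fin n) ℝ}
    (hA : A.IsHermitian) (i : Fin n) :
    (hA.eigenvectorBasis i).ofLp ⬝ᵥ (hA.eigenvectorBasis i).ofLp = 1 := by
  have h := (orthonormal_iff_ite.1 hA.eigenvectorBasis.orthonormal) i i
  rw [EuclideanSpace.inner_eq_star_dotProduct] at h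
  simpa only [star_trivial, if_true] using h

/-- **Eigenvalue form of [BiluLinial2006, Lemma 3.3], unconditional**: under the hypotheses of the
lemma (diagonal constant `c₁`) every eigenvalue `λᵢ` of the real symmetric matrix `A`
(Mathlib's `Matrix.IsHermitian.eigenvalues`) satisfies `|λᵢ| ≤ c₂·α(ln(d/α)+1)` — the printed
"spectral radius" conclusion. [cite: BiluLinial2006, Lemma 3.3 (p. 500)] -/
theorem BiluLinial2006_lemma_3_3_abs_eigenvalues_le (c₁ : ℝ) :
    ∃ c₂ : ℝ, ∀ (n : ℕ) (A : Matrix (Fin n) (Fin n) ℝ) (hA : A.IsHermitian) (d α : ℝ),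
      0 < α → α ≤ d →
      (∀ i, ∑ j, |A i j| ≤ d) →
      (∀ i, |A i i| ≤ c₁ * (α * (Real.log (d / α) + 1))) →
      (∀ u v : Fin n → ℝ, (∀ i, u i = 0 ∨ u i = 1) → (∀ i, v i = 0 ∨ v i = 1) →
          (∀ i, u i = 0 ∨ v i = 0) →
          |u ⬝ᵥ (A *ᵥ v)| ≤ α * Real.sqrt ((∑ i, u i) * (∑ i, v i))) →
      ∀ i, |hA.eigenvalues i| ≤ c₂ * (α * (Real.log (d / α) + 1)) := by
  obtain ⟨c₂, H⟩ := BiluLinial2006_lemma_3_3_holds c₁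
  refine ⟨c₂, fun n A hA d α hα hαd hrow hdiag hdisc i => ?_⟩
  have hsymm : A.IsSymm := by
    have h1 := hA
    rw [Matrix.IsHermitian, Matrix.conjTranspose_eq_transpose_of_trivial] at h1
    exact h1
  have hx := H n A d α hsymm hα hαd hrow hdiag hdisc (hA.eigenvectorBasis i).ofLp
  rw [hA.mulVec_eigenvectorBasis i, dotProduct_smul, smul_eq_mul,
    eigenvectorBasis_dotProduct_self hA i, mul_one, mul_one] at hx
  exact hx

end Literature.Combinatorics.Expanders
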